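import Literature.Geometry.Lorentzian.NearKerrLeaf
import Literature.Geometry.Lorentzian.FinalEraPackage2
import Summits.FinalStateConjecture.FinalStateConjecture.Statement
import Summits.FinalStateConjecture.FinalStateConjecture.Theses.DissipativeFinalMotions
import Summits.FinalStateConjecture.FinalStateConjecture.Theorems.BartnikGapSettlingCaptureStubClusterDispersesOfBudget
import HarnessLib

/-!
# Conditional closure of stub `stub_registration` (v3-S1b) of line `dilated-leaves-virial-certificate`
# of crux `Capture` (stmt-FinalStateConjecture-10115) from item `RadiativeLyapunovBudget` (stmt-10993)

The line `dilated-leaves-virial-certificate` of the crux `Capture` (routes `BartnikGapSettling` /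
`QuietWindowCapture`, summit `FinalStateConjecture`; skeleton
`Summits/FinalStateConjecture/FinalStateConjecture/Cruxes/Capture/Lines/dilated_leaves_virial_certificate.lean`,
v3) reads the crux as: near-sub-extremal-Kerr leaves ⇒ a rev-2 final-era package
`p : FinalEraPackage₂ 𝒟` (S1a, era entry) ⇒ REGISTERED DILATED EPOCHS of `p` (S1b, THIS stub: for
every `D₁, t₀` there are registration times `tᵣ i ≥ t₀` at which all pairs of worldlines `p.ξ i` are
`D₁`-apart, with slope `|tᵣ i − tᵣ j| ≤ θ‖p.ξ i (tᵣ i) − p.ξ j (tᵣ j)‖ + C₀`, `θ·p.V < 1`) ⇒ pairwise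
recurrence (S2, landed) ⇒ dispersal (S3/S4 landed; S5 ⇐ stmt-10993) ⇒ settles (S6 ≡ stmt-10994).

The OWN content of S1b is general-relativistic (a fine leaf beyond `J⁻(K)` crosses every certified
tube of the package only inside its own Kerr discs, by curvature exclusion against the `ε`-flat
sheet); no typed clause of `CauchyDevelopment.IsNearKerrLeaf` or of `FinalEraPackage₂` locates the
package worldlines `p.ξ` relative to a leaf `S` (the leaf's charts and the package's charts are
unrelated maps into `𝒟.carrier`, linked only through causal-set inclusions), so no unconditional
proof is available in the present library.  This file records, kernel-checked, that the stub is
nevertheless CARRIED by the ONE existing named item that already carries the cluster sector S5: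

* `registered_of_disperses` — pure kinematics: worldlines `ξ : Fin N → ℝ → E3` whose pairwise
  separations tend to infinity have registered dilated epochs with `θ = C₀ = 0` and COMMON
  registration times (finitely many pairs are simultaneously `D₁`-apart at all late times,
  `Filter.eventually_all`); registration is thus NECESSARY for the dispersal the line feeds to S6;
* `registered_of_radiativeLyapunovBudget` — item `RadiativeLyapunovBudget` of route
  `DissipativeFinalMotions` (stmt-FinalStateConjecture-10993, OPEN) gives dispersal of EVERY rev-2
  package of an admissible MGHD with complete `𝓘⁺`
  (`disperses_of_radiativeLyapunovBudget`, landed with `stub_clusterDisperses_of_radiativeLyapunovBudget`,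
  itself fed by the PROVED item `DispersalFromBudget`, stmt-FinalStateConjecture-10156), hence
  registration of every such package;
* `stub_registration_of_radiativeLyapunovBudget` — hence the registered signature of
  `stub_registration`, VERBATIM, under that single named hypothesis (registered helper sub-goal of
  the crux item; the precise sense of "S1b is blocked on stmt-10993").  The leaves and the tuple
  `(N₀, m₀, χ, k₁, ε₁)` are not used.

No definitions; no new named facts (the hypothesis is the existing route item, imported from its
`Theses` file as CONVENTIONS §2 permits for `Theorems` files).

References: Dafermos–Luk arXiv:1710.01722, p. 8 (the final-era picture); Marchal–Saari,
J. Differential Equations 20 (1976), Thm 1 (dispersal vocabulary).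
-/

-- the doubled `FinalStateConjecture.FinalStateConjecture` path component trips dupNamespace
set_option linter.dupNamespace false

noncomputable section

namespace Summit.FinalStateConjecture.FinalStateConjecture.Theorems.BartnikGapSettling.Capture

open Set Filter Function Topology
open scoped Manifold ContDiff ENNReal BigOperators
open Literature.Geometry.Lorentzian

/-- **Dispersal registers** (kinematics; `θ = C₀ = 0`, common registration times): if finitely many
worldlines `ξ : Fin N → ℝ → E3` pairwise disperse, `‖ξ i t - ξ j t‖ → ∞` for `i ≠ j`, then for every
`D₁, t₀` there are registration times `tᵣ i ≥ t₀` (all equal to one late time `t`) at which every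
pair is `D₁`-apart, with slope bound `|tᵣ i - tᵣ j| ≤ 0 * ‖…‖ + 0`; and `0 * V < 1` for any `V`.
Proof: the finitely many events `D₁ ≤ ‖ξ i t - ξ j t‖` all hold eventually (`Filter.eventually_all`),
as does `t₀ ≤ t`; pick a witness. [folklore] -/
theorem registered_of_disperses {N : ℕ} (V : ℝ) (ξ : Fin N → ℝ → E3)
    (h : ∀ i j, i ≠ j → Tendsto (fun t ↦ ‖ξ i t - ξ j t‖) atTop atTop) :
    ∃ θ C₀ : ℝ, θ * V < 1 ∧ ∀ D₁ t₀ : ℝ, ∃ tᵣ : Fin N → ℝ, (∀ i, t₀ ≤ tᵣ i) ∧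
      ∀ i j, i ≠ j → |tᵣ i - tᵣ j| ≤ θ * ‖ξ i (tᵣ i) - ξ j (tᵣ j)‖ + C₀ ∧
        D₁ ≤ ‖ξ i (tᵣ i) - ξ j (tᵣ j)‖ := by
  refine ⟨0, 0, by simp, fun D₁ t₀ ↦ ?_⟩
  have hev : ∀ᶠ t in atTop, ∀ i j, i ≠ j → D₁ ≤ ‖ξ i t - ξ j t‖ := by
    simp only [Filter.eventually_all]
    intro i j hij
    exact (h i j hij).eventually_ge_atTop D₁
  obtain ⟨t, ht⟩ := (hev.and (eventually_ge_atTop t₀)).exists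
  exact ⟨fun _ ↦ t, fun _ ↦ ht.2, fun i j hij ↦ ⟨by simp, ht.1 i j hij⟩⟩

/-- **Every rev-2 final-era package is registered, given the radiative Lyapunov budget** (item
`RadiativeLyapunovBudget`, stmt-FinalStateConjecture-10993): for admissible data, an MGHD with
complete `𝓘⁺` and any `p : FinalEraPackage₂ 𝒟`, the package disperses
(`disperses_of_radiativeLyapunovBudget`, via the PROVED item `DispersalFromBudget`,
stmt-FinalStateConjecture-10156), hence has registered dilated epochs (`registered_of_disperses`).
[folklore] -/
theorem registered_of_radiativeLyapunovBudget
    (hB : Summit.FinalStateConjecture.FinalStateConjecture.Theses.DissipativeFinalMotions.RadiativeLyapunovBudget) :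
    ∀ (X : Type) [TopologicalSpace X] [ChartedSpace E3 X] [IsManifold (𝓡 3) ∞ X] [T2Space X]
      [SecondCountableTopology X] [ConnectedSpace X],
      ∀ D ∈ admissibleVacuumData X, ∀ 𝒟 : VacuumCauchyDevelopment D, 𝒟.IsMaximal →
        Summit.FinalStateConjecture.HasCompleteNullInfinity 𝒟.toCauchyDevelopment →
          ∀ p : FinalEraPackage₂ 𝒟.toCauchyDevelopment,
            ∃ θ C₀ : ℝ, θ * p.V < 1 ∧ ∀ D₁ t₀ : ℝ, ∃ tᵣ : Fin p.N → ℝ, (∀ i, t₀ ≤ tᵣ i) ∧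
              ∀ i j, i ≠ j → |tᵣ i - tᵣ j| ≤ θ * ‖p.ξ i (tᵣ i) - p.ξ j (tᵣ j)‖ + C₀ ∧
                D₁ ≤ ‖p.ξ i (tᵣ i) - p.ξ j (tᵣ j)‖ := by
  intro X _ _ _ _ _ _ D hD 𝒟 hmax hCNI p
  exact registered_of_disperses p.V p.ξ
    (disperses_of_radiativeLyapunovBudget hB X D hD 𝒟 hmax hCNI p)

/-- **Stub S1b (v3) is carried by item `RadiativeLyapunovBudget`** (stmt-FinalStateConjecture-10993):
the registered signature of `stub_registration`, VERBATIM, under that single named hypothesis — the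
near-sub-extremal-Kerr leaves and the tuple `(N₀, m₀, χ, k₁, ε₁)` are not used
(`registered_of_radiativeLyapunovBudget`). [folklore] -/
theorem stub_registration_of_radiativeLyapunovBudget :
    Summit.FinalStateConjecture.FinalStateConjecture.Theses.DissipativeFinalMotions.RadiativeLyapunovBudget →
    ∀ (X : Type) [TopologicalSpace X] [ChartedSpace E3 X] [IsManifold (𝓡 3) ∞ X] [T2Space X]
      [SecondCountableTopology X] [ConnectedSpace X],
      ∀ D ∈ admissibleVacuumData X, ∀ 𝒟 : VacuumCauchyDevelopment D, 𝒟.IsMaximal →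
        Summit.FinalStateConjecture.HasCompleteNullInfinity 𝒟.toCauchyDevelopment →
          ∀ (N₀ : ℕ) (m₀ χ : ℝ) (k₁ : ℕ) (ε₁ : ℝ≥0∞), 0 < m₀ → χ < 1 → 0 < ε₁ →
            (∀ (k : ℕ) (ε : ℝ≥0∞), 0 < ε → ∀ K : Set 𝒟.carrier, IsCompact K →
              ∃ (N : ℕ) (M a : Fin N → ℝ) (S : Set 𝒟.carrier), N ≤ N₀ ∧
                (∀ i, m₀ ≤ M i ∧ M i ≤ m₀⁻¹) ∧
                  Disjoint S (𝒟.metric.causalPast 𝒟.timeOrientation K) ∧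
                    𝒟.toCauchyDevelopment.IsNearKerrLeaf k ε N M a S ∧
                      (k₁ ≤ k → ε ≤ ε₁ → ∀ i, |a i| ≤ χ * M i)) →
            ∀ p : FinalEraPackage₂ 𝒟.toCauchyDevelopment,
              ∃ θ C₀ : ℝ, θ * p.V < 1 ∧ ∀ D₁ t₀ : ℝ, ∃ tᵣ : Fin p.N → ℝ, (∀ i, t₀ ≤ tᵣ i) ∧
                ∀ i j, i ≠ j → |tᵣ i - tᵣ j| ≤ θ * ‖p.ξ i (tᵣ i) - p.ξ j (tᵣ j)‖ + C₀ ∧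
                  D₁ ≤ ‖p.ξ i (tᵣ i) - p.ξ j (tᵣ j)‖ := by
  intro hB X _ _ _ _ _ _ D hD 𝒟 hmax hCNI N₀ m₀ χ k₁ ε₁ _ _ _ _ p
  exact registered_of_radiativeLyapunovBudget hB X D hD 𝒟 hmax hCNI p

end Summit.FinalStateConjecture.FinalStateConjecture.Theorems.BartnikGapSettling.Capture

end
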